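import Summits.BirchSwinnertonDyer.BirchSwinnertonDyer.Theorems.PrintCf2RubinValueTwoKatzPeriodRigidityJZeroOfSupply
import Summits.BirchSwinnertonDyer.BirchSwinnertonDyer.Theorems.PrintCf2RubinValueTwoFrameSeedJZero
import Summits.BirchSwinnertonDyer.BirchSwinnertonDyer.Theorems.CycTangentCMCycTangentBoundInterpolationContinuation
import Literature.NumberTheory.EllipticCurves.ZpExtensionTorsionCharacterPadicAvatar
import Literature.NumberTheory.EllipticCurves.DeShalit1987.KatzMeasurePointTransport
import Literature.NumberTheory.EllipticCurves.DeShalit1987.KatzMeasureMonomialLinesFrames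
import Literature.NumberTheory.EllipticCurves.IntSeriesValueNormRigidity
import HarnessLib

set_option linter.dupNamespace false
set_option autoImplicit false

/-!
# `j = 0` TWO-VARIABLE KATZ PERIOD RIGIDITY ON THE SPLIT DYADIC FRAME, GIVEN THE `(−N, 0)`-POWER SUPPLY (piece S4 of the LEAD memo
# `Cruxes/KatzDistributionsAtTwoPrint/LEAD-MEMO-JZERO-RIGIDITY-g18.md`, with S3 as a typed hypothesis)

Cell `bsd-print-cf2`, LEAD seat `bsd-line-cf2-p1` g18; `--supports stmt-BirchSwinnertonDyer-24720` (helper, Theses-free). THEOREMS ONLY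
(no `def`, no named fact, no `sorry`); nothing is closed; BSD is not proved by any of this.

ASSEMBLY of the torsion supply of the socket `KatzPeriodRigidity.span_eq_span_of_isKatzMeasure₂₀_of_torsionSupply` (p761646) on the core
binders of `span_eq_span_DA7` (`K` imaginary quadratic ∋ `√−7`, `ord_v 2 = 1`, `2 ∈ 𝔭_v, 𝔭_v̄`, `ι` pinned to `v`, a generator pair with the
second line unramified outside `v̄`, `θK² = 1` unramified off `S ∪ {v, v̄}`), from THREE supplies:
* S1 the seed `η` (`FrameSeed.exists_seed_core₀`, p761907: type `(−a, 0)`, avatar `e` through the pair, `θK⁻¹η` unramified at `v`);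
* S2 the torsion characters of the `v̄`-line (`ZpExtension.exists_isFiniteOrder_isPAdicAvatarOf_torsion_pair_right`, -w7 g14 p762176: finite
  order `ω_ζ` through the pair with `ω̂(γ₁⁻¹) = 1`, `ω̂(γ₂⁻¹) = ζ`, unramified off `v̄`);
* S3 the `(−N, 0)`-POWER SUPPLY — HERE A HYPOTHESIS `hpow` (to be discharged by the lane): for every `k`, an everywhere-unramified `Φ_k` of
  type `(−s·k, 0)` (`s > 0`) with avatar `f_k` through the pair, `f_k(γ₁) = u^k`, `f_k(γ₂) = 1`, for ONE one-unit `u ≠ 1` of level `< ‖2‖`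
  (Steps 1–2 of `exists_frameSupply₂` give `Φ_k = Ψ₁^{Wk}`; the two values are the `j = 0` novelties: `γ₂ ∈ I_v̄` sees weight `0`, and
  `u ≠ 1` by `not_isUnramifiedAt_avatar_of_hasInfinityType_ne_zero`).
The supplied character is `ρ_{t,ζ} = ω_{ζ⁻¹} · (Φ_{t+3} · η)` with avatar `twist (twist e (detChar f)) (detChar r_ω)`; its values at the
frame's generators `γ₁⁻¹, γ₂⁻¹` are `(u⁻¹)^3·e(γ₁⁻¹) · (u⁻¹)^t` and `e(γ₂⁻¹) · ζ`.

* ★★ `span_eq_span_core₀_of_powerSupply` — on those binders, two solutions `G ≠ 0`, `G'` of `IsKatzMeasure₂₀ ι v v̄ S κ₁ κ₂ γ₁⁻¹ γ₂⁻¹ θK⁻¹`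
  at two period triples generate the same ideal, GIVEN the power supply;
* `charIdeal_clause_transport_core₀_of_powerSupply`.
The DA7-binder forms (`d_K = −7`, framed `θ` with `IsHeckeCharOf`) and `powForm_forall_of_oneTriple₀` follow exactly as in
`…KatzPeriodRigidityDA7` once S3 is a theorem (sequel).

References: [deShalit1987] II.4.12 Remarks (iii)–(iv) (p. 66–67), II.4.16 (49)–(50) (p. 76–77), II.4.17 (52)–(54) (p. 77–78); [Washington1997] §13.1;
[Gouvea1993PadicNumbers] §5.9.
-/

noncomputable section

open scoped NumberField Classical Topology
open Filter NumberField IsDedekindDomain Field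
open Literature Literature.NumberTheory.GaloisRepresentations Literature.NumberTheory.EllipticCurves
open Summit.BirchSwinnertonDyer.BirchSwinnertonDyer.Theorems.CycTangentCMCycTangentBoundInterpolationContinuation

namespace Summit.BirchSwinnertonDyer.BirchSwinnertonDyer.Theorems.PrintCf2.KatzPeriodRigidity

variable {K : Type} [Field K] [NumberField K]

/-- Values of a rank-one framed representation at inverses. [folklore] -/
private theorem avatarValueAt_inv_eq (r : FramedGaloisRep K (PadicAlgCl 2) 1) (γ : absoluteGaloisGroup K) :
    avatarValueAt r γ⁻¹ = (avatarValueAt r γ)⁻¹ := by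
  have h0 : avatarValueAt r γ ≠ 0 := fun h ↦ by
    have h1 := norm_avatarValueAt_eq_one r γ
    rw [h, norm_zero] at h1
    exact zero_ne_one h1
  have hmul : avatarValueAt r γ * avatarValueAt r γ⁻¹ = 1 := by rw [← avatarValueAt_mul, mul_inv_cancel, avatarValueAt_one]
  exact (eq_inv_of_mul_eq_one_right hmul)

/-- One-units multiply. [folklore] -/
private theorem norm_mul_sub_one_lt_one {x y : ℂ_[2]} (hx : ‖x - 1‖ < 1) (hy : ‖y - 1‖ < 1) : ‖x * y - 1‖ < 1 := by
  have hy1 : ‖y‖ = 1 := by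
    have hh := IsUltrametricDist.norm_add_eq_max_of_norm_ne_norm (x := y - 1) (y := (1 : ℂ_[2])) (by rw [norm_one]; exact hy.ne)
    rw [sub_add_cancel, norm_one] at hh
    rw [hh]
    exact max_eq_right hy.le
  have e : x * y - 1 = (x - 1) * y + (y - 1) := by ring
  rw [e]
  refine (IsUltrametricDist.norm_add_le_max _ _).trans_lt (max_lt ?_ hy)
  rw [norm_mul, hy1, mul_one]
  exact hx

/-- Powers of a one-unit are one-units. [folklore] -/
private theorem norm_pow_sub_one_lt_one {x : ℂ_[2]} (hx : ‖x - 1‖ < 1) (n : ℕ) : ‖x ^ n - 1‖ < 1 := by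
  induction n with
  | zero => rw [pow_zero, sub_self, norm_zero]; exact one_pos
  | succ n ih => rw [pow_succ]; exact norm_mul_sub_one_lt_one ih hx

/-- The inverse of a one-unit is a one-unit of the same level. [folklore] -/
private theorem norm_inv_sub_one_eq' {x : ℂ_[2]} (hx : ‖x - 1‖ < 1) : ‖x⁻¹ - 1‖ = ‖x - 1‖ := by
  have hx1 : ‖x‖ = 1 := by
    have hh := IsUltrametricDist.norm_add_eq_max_of_norm_ne_norm (x := x - 1) (y := (1 : ℂ_[2])) (by rw [norm_one]; exact hx.ne)
    rw [sub_add_cancel, norm_one] at hh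
    rw [hh]
    exact max_eq_right hx.le
  have hx0 : x ≠ 0 := fun h ↦ by rw [h, norm_zero] at hx1; exact zero_ne_one hx1
  have e : x⁻¹ - 1 = -(x⁻¹ * (x - 1)) := by rw [mul_sub, inv_mul_cancel₀ hx0, mul_one, neg_sub]
  rw [e, norm_neg, norm_mul, norm_inv, hx1, inv_one, one_mul]

/-- ★★ **`j = 0` TWO-VARIABLE KATZ PERIOD RIGIDITY ON THE CORE FRAME, GIVEN THE `(−N, 0)`-POWER SUPPLY.** `K` imaginary quadratic with
`√−7 ∈ K`; `2 ∈ 𝔭_v`, `ord_v 2 = 1` (`v̄` enters only through `κ₂` and `S`); `ι` pinned to `v`; a generator pair `(κ₁, κ₂; γ₁, γ₂)` with `κ₂` unramified outside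
`v̄`; `θK² = 1` unramified off `S ∪ {v, v̄}`; the power supply `hpow` (S3: `Φ_k` of type `(−s·k, 0)`, everywhere unramified, avatar `f_k`
through the pair, `f_k(γ₁) = u^k`, `f_k(γ₂) = 1`, `u ≠ 1`, `‖u − 1‖ < ‖2‖`). Then two solutions `G ≠ 0` (at `(Ω, δ, Ω_p)`) and `G'` (at
`(Ω', δ', Ω_p')`) of `IsKatzMeasure₂₀ ι v v̄ S κ₁ κ₂ γ₁⁻¹ γ₂⁻¹ θK⁻¹ …` satisfy `Ideal.span {G'} = Ideal.span {G}`.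
[cite: deShalit1987, II.4.12 Remarks (iii)–(iv) (p. 66–67), II.4.17 (52)–(54) (p. 77–78)] [cite: Washington1997, §13.1] -/
theorem span_eq_span_core₀_of_powerSupply (hK : IsImaginaryQuadratic K) {θ₇ : K} (hθ7 : θ₇ ^ 2 = -7)
    {v vbar : HeightOneSpectrum (𝓞 K)} (hv : ((2 : ℕ) : 𝓞 K) ∈ v.asIdeal)
    (h2v : v.intValuation (2 : 𝓞 K) = WithZero.exp (-1 : ℤ)) {ι : PadicAlgCl 2 ≃+* ℂ}
    (hι : ∀ (w : InfinitePlace K) (k : 𝓞 K), k ∈ v.asIdeal ↔ ‖ι.symm (w.embedding (k : K))‖ < 1)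
    {κ₁ κ₂ : ZpExtension K 2} {γ₁ γ₂ : absoluteGaloisGroup K} (hpair : ZpExtension.IsTopGeneratorPair κ₁ κ₂ γ₁ γ₂)
    (hκ₂ : κ₂.IsUnramifiedOutside vbar)
    {θK : HeckeCharacter K} (hθ : θK * θK = 1) {S : Finset (HeightOneSpectrum (𝓞 K))}
    (hSunr : ∀ w : HeightOneSpectrum (𝓞 K), w ∉ S → w ≠ v → w ≠ vbar → θK.IsUnramifiedAt w)
    -- S3, the power supply
    {s : ℕ} (hs : 0 < s) {u : ℂ_[2]} (hu2 : ‖u - 1‖ < ‖((2 : ℕ) : ℂ_[2])‖) (hu1 : u ≠ 1)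
    (hpow : ∀ k : ℕ, ∃ (Φ : HeckeCharacter K) (f : FramedGaloisRep K (PadicAlgCl 2) 1),
      IsPAdicAvatarOf ι Φ f ∧ FactorsThroughPair κ₁ κ₂ f ∧
      Φ.HasInfinityType (fun _ ↦ -((s * k : ℕ) : ℤ)) (fun _ ↦ 0) ∧
      (∀ w : HeightOneSpectrum (𝓞 K), Φ.IsUnramifiedAt w) ∧
      avatarValueAt f γ₁ = u ^ k ∧ avatarValueAt f γ₂ = 1)
    {Ω δ Ω' δ' : ℂ} {Ωp Ωp' : ℂ_[2]} {G G' : PowerSeries (PowerSeries (PadicComplexInt 2))}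
    (hG : IsKatzMeasure₂₀ ι v vbar S κ₁ κ₂ γ₁⁻¹ γ₂⁻¹ θK⁻¹ Ω δ Ωp G)
    (hG' : IsKatzMeasure₂₀ ι v vbar S κ₁ κ₂ γ₁⁻¹ γ₂⁻¹ θK⁻¹ Ω' δ' Ωp' G')
    (hΩ : Ω ≠ 0) (hδ : δ ≠ 0) (hΩp : Ωp ≠ 0) (hΩ' : Ω' ≠ 0) (hΩp' : Ωp' ≠ 0) (hG0 : G ≠ 0) :
    Ideal.span {G'} = Ideal.span {G} := by
  have hp : (2 : ℕ).Prime := Fact.out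
  -- S1: the seed
  obtain ⟨η, e, a, he, heκ, hη2, hηv, hηt, hηu⟩ := FrameSeed.exists_seed_core₀ hK hθ7 hv h2v ι hι hpair hθ hSunr
  -- the node base of the socket is `u⁻¹`, the offsets are `(u⁻¹)^3 · e(γ₁⁻¹)` and `e(γ₂⁻¹)`
  have hp1 : ‖((2 : ℕ) : ℂ_[2])‖ ≤ 1 := IsUltrametricDist.norm_natCast_le_one ℂ_[2] 2
  have hu : ‖u - 1‖ < 1 := hu2.trans_le hp1
  have hui : ‖u⁻¹ - 1‖ < 1 := by rw [norm_inv_sub_one_eq' hu]; exact hu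
  have hroot : ∀ n : ℕ, 0 < n → u⁻¹ ^ n ≠ 1 := fun n hn h1 ↦ by
    apply IntSeries.forall_pow_ne_one_of_norm_sub_one_lt hu1 hu2 n hn
    rw [inv_pow] at h1
    exact inv_eq_one.mp h1
  have hw₁ : ‖u⁻¹ ^ 3 * avatarValueAt e γ₁⁻¹ - 1‖ < 1 :=
    norm_mul_sub_one_lt_one (norm_pow_sub_one_lt_one hui 3) (norm_avatarValueAt_sub_one_lt_of_factorsThroughPair heκ γ₁⁻¹)
  have hw₂ : ‖avatarValueAt e γ₂⁻¹ - 1‖ < 1 := norm_avatarValueAt_sub_one_lt_of_factorsThroughPair heκ γ₂⁻¹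
  -- the type and ramification of `θK⁻¹` bookkeeping
  haveI : IsTotallyComplex K := hK.2
  refine span_eq_span_of_isKatzMeasure₂₀_of_torsionSupply hG hG' hΩ hδ hΩp hΩ' hΩp' hG0 hui hroot hw₁ hw₂
    (m₀ := a + s * 3) hs 0 fun t n ζ _ hζ ↦ ?_
  -- the torsion supply at `(t, ζ)`
  have hζ0 : ζ ≠ 0 := hζ.ne_zero (pow_ne_zero _ hp.ne_zero)
  have hζi : ζ⁻¹ ^ 2 ^ n = 1 := by rw [inv_pow, hζ.pow_eq_one, inv_one]
  -- S2: the torsion character with `ω̂(γ₁⁻¹) = 1`, `ω̂(γ₂⁻¹) = ζ`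
  obtain ⟨ω, rω, -, hωt, hωav, -, hωκ, -, -, hω₁, hω₂, hωu2, hωu⟩ :=
    ZpExtension.exists_isFiniteOrder_isPAdicAvatarOf_torsion_pair_right ι hpair n hζi
  rw [inv_inv] at hω₂
  -- S3: the power at `k = t + 3`
  obtain ⟨Φ, f, hfav, hfκ, hΦt, hΦu, hf₁, hf₂⟩ := hpow (t + 3)
  -- the supplied character `ρ = ω · (Φ · η)` with avatar `twist (twist e (detChar f)) (detChar rω)`
  have hav : IsPAdicAvatarOf ι (ω * (Φ * η)) (FramedRep.twist (FramedRep.twist e (detChar f)) (detChar rω)) :=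
    (he.mul_twist hfav (fun w _ ↦ hΦu w)).mul_twist hωav hωu2
  have hκ : FactorsThroughPair κ₁ κ₂ (FramedRep.twist (FramedRep.twist e (detChar f)) (detChar rω)) :=
    factorsThroughPair_twist_detChar (factorsThroughPair_twist_detChar heκ hfκ) hωκ
  refine ⟨ω * (Φ * η), FramedRep.twist (FramedRep.twist e (detChar f)) (detChar rω), hav, hκ, by omega, ?_, ?_, ?_, ?_, ?_⟩
  · -- type `(−(m₀ + s t), 0)` of `θK⁻¹ρ = ω · (Φ · (θK⁻¹η))`
    have hrew : θK⁻¹ * (ω * (Φ * η)) = ω * (Φ * (θK⁻¹ * η)) := by rw [mul_left_comm θK⁻¹, mul_left_comm θK⁻¹]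
    rw [hrew]
    have h := hωt.mul' (hΦt.mul' hηt)
    convert h using 2 <;> (simp only [Pi.add_apply]; push_cast; try ring)
  · -- unramified off `S ∪ {v̄}`
    intro w hwS hwv
    have hrew : θK⁻¹ * (ω * (Φ * η)) = ω * (Φ * (θK⁻¹ * η)) := by rw [mul_left_comm θK⁻¹, mul_left_comm θK⁻¹]
    rw [hrew]
    exact (hωu vbar hκ₂ w hwv).mul' ((hΦu w).mul' (hηu w hwS hwv))
  · -- entire `L`-function
    have hrew : θK⁻¹ * (ω * (Φ * η)) = ω * (Φ * (θK⁻¹ * η)) := by rw [mul_left_comm θK⁻¹, mul_left_comm θK⁻¹]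
    rw [hrew]
    have h := hωt.mul' (hΦt.mul' hηt)
    have hinf : (ω * (Φ * (θK⁻¹ * η))).HasInfinityType (fun _ ↦ -((a + s * 3 + s * t : ℕ) : ℤ)) (fun _ ↦ ((0 : ℕ) : ℤ)) := by
      convert h using 2 <;> (simp only [Pi.add_apply]; push_cast; try ring)
    exact hasEntireContinuation_of_hasInfinityType hK (by omega) hinf
  · -- value at `γ₁⁻¹`
    rw [avatarValueAt_twist_detChar, avatarValueAt_twist_detChar, hω₁, one_mul, avatarValueAt_inv_eq f γ₁, hf₁, ← inv_pow, pow_add]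
    ring
  · -- value at `γ₂⁻¹`
    rw [avatarValueAt_twist_detChar, avatarValueAt_twist_detChar, hω₂, avatarValueAt_inv_eq f γ₂, hf₂, inv_one, one_mul, mul_comm]

/-- **The main-conjecture clause is period-independent on the core frame at `j = 0`, given the power supply**: for any ideal `I`,
`I = (G) ↔ I = (G')`. [cite: deShalit1987, II.4.12 Remarks (iii)–(iv) (p. 66–67)] -/
theorem charIdeal_clause_transport_core₀_of_powerSupply (hK : IsImaginaryQuadratic K) {θ₇ : K} (hθ7 : θ₇ ^ 2 = -7)
    {v vbar : HeightOneSpectrum (𝓞 K)} (hv : ((2 : ℕ) : 𝓞 K) ∈ v.asIdeal)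
    (h2v : v.intValuation (2 : 𝓞 K) = WithZero.exp (-1 : ℤ)) {ι : PadicAlgCl 2 ≃+* ℂ}
    (hι : ∀ (w : InfinitePlace K) (k : 𝓞 K), k ∈ v.asIdeal ↔ ‖ι.symm (w.embedding (k : K))‖ < 1)
    {κ₁ κ₂ : ZpExtension K 2} {γ₁ γ₂ : absoluteGaloisGroup K} (hpair : ZpExtension.IsTopGeneratorPair κ₁ κ₂ γ₁ γ₂)
    (hκ₂ : κ₂.IsUnramifiedOutside vbar)
    {θK : HeckeCharacter K} (hθ : θK * θK = 1) {S : Finset (HeightOneSpectrum (𝓞 K))}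
    (hSunr : ∀ w : HeightOneSpectrum (𝓞 K), w ∉ S → w ≠ v → w ≠ vbar → θK.IsUnramifiedAt w)
    {s : ℕ} (hs : 0 < s) {u : ℂ_[2]} (hu2 : ‖u - 1‖ < ‖((2 : ℕ) : ℂ_[2])‖) (hu1 : u ≠ 1)
    (hpow : ∀ k : ℕ, ∃ (Φ : HeckeCharacter K) (f : FramedGaloisRep K (PadicAlgCl 2) 1),
      IsPAdicAvatarOf ι Φ f ∧ FactorsThroughPair κ₁ κ₂ f ∧
      Φ.HasInfinityType (fun _ ↦ -((s * k : ℕ) : ℤ)) (fun _ ↦ 0) ∧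
      (∀ w : HeightOneSpectrum (𝓞 K), Φ.IsUnramifiedAt w) ∧
      avatarValueAt f γ₁ = u ^ k ∧ avatarValueAt f γ₂ = 1)
    {Ω δ Ω' δ' : ℂ} {Ωp Ωp' : ℂ_[2]} {G G' : PowerSeries (PowerSeries (PadicComplexInt 2))}
    (hG : IsKatzMeasure₂₀ ι v vbar S κ₁ κ₂ γ₁⁻¹ γ₂⁻¹ θK⁻¹ Ω δ Ωp G)
    (hG' : IsKatzMeasure₂₀ ι v vbar S κ₁ κ₂ γ₁⁻¹ γ₂⁻¹ θK⁻¹ Ω' δ' Ωp' G')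
    (hΩ : Ω ≠ 0) (hδ : δ ≠ 0) (hΩp : Ωp ≠ 0) (hΩ' : Ω' ≠ 0) (hΩp' : Ωp' ≠ 0) (hG0 : G ≠ 0)
    (I : Ideal (PowerSeries (PowerSeries (PadicComplexInt 2)))) : I = Ideal.span {G} ↔ I = Ideal.span {G'} := by
  rw [span_eq_span_core₀_of_powerSupply hK hθ7 hv h2v hι hpair hκ₂ hθ hSunr hs hu2 hu1 hpow hG hG' hΩ hδ hΩp hΩ' hΩp' hG0]

end Summit.BirchSwinnertonDyer.BirchSwinnertonDyer.Theorems.PrintCf2.KatzPeriodRigidity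

end
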